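import Summits.BirchSwinnertonDyer.Rank1Residual.Additive.X4SharpUnitFreeResidueSharp
import Summits.BirchSwinnertonDyer.Rank1Residual.Additive.X4RankZeroKuriharaWitness
import Summits.BirchSwinnertonDyer.Rank1Residual.Supersingular.SignedRankZero
import HarnessLib

/-!
# X4♯(unit-free) ⟺ Kim's Conjecture 1.10 in OUTPUT FORM on the named rows ∧ the exotic-image residue at `3`
# — the END STATE of class X4 (r = 0) re-expressed through the Kurihara-number currency
# (cell `b2b-bsdres`, seat additive-p4 gen 16, line V28; CLASS-CLOSURE §3.1 N11 / §3.2 N10: "the irreducible residue named precisely")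

HONEST FRAMING (cell `b2b-bsdres`, run/shared/lean/b2b/bsd-rank1-residual/, verbatim in every
file): the goal of the cell is to DELETE the COMBINATION-SHAPED residual classes of the
Birch–Swinnerton-Dyer formula for ALL analytic-rank `≤ 1` elliptic curves over `ℚ` — "full BSD
formula for every rank `≤ 1` curve in class `C`" assembled STRICTLY from published theorems — so
that the rank-`≤ 1` remainder becomes exactly the CONSTRUCTION-SHAPED classes, which are TYPED
(missing-input `Prop`s), NOT attempted. This is not "finishing BSD". Sub-cell additive-p4 (X3♯/X4♯
direct): research route on the CONSTRUCTION-SHAPED class X4; a REDUCTION of the typed conjecture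
`X4SharpUnitFree` to named per-pair shapes, not a proof of it; the label X4 is UNCHANGED; nothing is
booked by this file. Theorems only (no definition, no named fact minted; every published input is an
explicit named-fact hypothesis; NO Kurihara-number theorem and NO conjecture is assumed).

## What this file proves

Gen 14's end state (`x4SharpUnitFree_iff_lower_and_residues_sharp`, p246578) says, modulo EIGHT
published facts + GZK + modularity: X4♯(unit-free) ⟺ LOWER ∧ EXOTIC ∧ TAM-DEFECT₂♭ ∧ ODD-SHA♭ ∧
MANIN♭. C.-H. Kim's Conjecture 1.9 (*Amer. J. Math.* 148 (2026); = arXiv v4 Conj. 1.10, PDF p. 8: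
"`∂^{(∞)}(δ̃) = Σ_{ℓ∣N} ord_p(c_ℓ)`", `p ≥ 5`, `ρ̄` onto, Manin prime to `p`; restated for
`p ≥ 3` under large image as Conj. 7.4 of Kim, arXiv:2505.09121, 2025) has, through Kim's structure
theorem `length Ш[p^∞] = ∂^{(0)}(δ̃) − ∂^{(∞)}(δ̃)` (Thm. 1.8 (6), `p ≥ 5` PUBLISHED; Thm. 1.1 of the
2025 preprint at `p ≥ 3`, ANNOUNCED), two per-pair OUTPUT SHAPES in the tree's currency
(`L(E,1)/Ω(W) = q₀ ∈ ℚ`):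
* the **'≤' half** (ONE Kolyvagin level `n` with `ord(δ̃_n) = j ≤ ord_p ∏ c_ℓ`) delivers
  `ord_p q₀ − j ≤ ord_p #Ш(p)` — the LOWER-WITNESS shape (socket: `Additive/X4RankZeroKuriharaWitness.lean`);
* the **'≥' half** (ALL `δ̃_n` divisible by `p^{ord_p ∏ c_ℓ}`) delivers `ord_p #Ш(p) + ord_p ∏ c_ℓ ≤ ord_p q₀`
  — the UPPER-DIVISIBILITY shape (socket: §1 below).
THIS FILE (fact-agnostic; neither Kim's theorems nor his conjecture are hypotheses):
* §1 `missingUpperBoundAt_of_rankZero_of_LOmegaDivisibility` (class-free dual of gen 16's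
  `missingLowerBoundAt_of_rankZero_of_LOmegaWitness`) and the converse bookkeeping
  `LOmegaShapes_of_missingPPartAt_rankZero` (`MissingPPartAt` ⟹ both shapes, with equality).
* §2 **`x4SharpUnitFree_iff_kuriharaShapes_and_exotic`**: modulo the same eight facts,
  **X4♯(unit-free) ⟺ (LOWER-WITNESS shape on every X4 ∧ `r_an = 0` ∧ surj(p) pair)
  ∧ (UPPER-DIVISIBILITY shape on the TAM-DEFECT₂♭ ∪ ODD-SHA♭ ∪ MANIN♭ pairs)
  ∧ EXOTIC(3)** — i.e. the residue of class X4 (rank `0`, unit-free part; = RESIDUAL-MAP §I N11 ∪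
  N10 ∩ X4) is EXACTLY Kim's Conjecture 1.10 in output form on the named rows plus the
  exotic-`3`-adic-image rows (where no Kurihara-number theorem applies: large image fails). Per the
  CLASS-CLOSURE plan this names the irreducible residue precisely: the '≤' half is finitely
  certifiable per pair (one `δ̃_n`), the '≥' half is not (proved at good ordinary `p` by
  Burungale–Castella–Grossi–Skinner; open at an additive `p`; Büyükboduk 2009 gives one factor).

References: Kim 2026 [Kim2022StructureSelmer] Thm. 1.8 (6), §1.5.1, Conj. 1.9 (journal numbering);
Kim 2025 arXiv:2505.09121 Thm. 1.1, Conj. 7.4 (PRE; context only); Kato 2004 [Kato2004Asterisque]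
Thm. 14.5 (3), Prop. 14.16 (2), §13; Delbourgo 1998 [Delbourgo1998] Prop. 4; Wuthrich 2014
[Wuthrich2014] Lemma 20, Thm. 16; Silverman *AEC* [SilvermanAEC2009] Thm. X.4.14; Miller 2011
[Miller2011LMS] Def. 1.1.
-/

noncomputable section

open scoped Classical

open WeierstrassCurve Literature.NumberTheory.EllipticCurves
  Literature.NumberTheory.EllipticCurves.ModularForms
  Literature.NumberTheory.EllipticCurves.Rank1Residual
  Literature.NumberTheory.EllipticCurves.Rank1Residual.Typed

namespace Summit.BirchSwinnertonDyer.Rank1Residual.Additive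

section ClassFree

variable (W : WeierstrassCurve ℚ) [W.IsElliptic] (p : ℕ) [hp : Fact p.Prime]

/-! ### §1 Class-free bookkeeping: the UPPER-DIVISIBILITY shape; the converse -/

/-- **The UPPER half from the UPPER-DIVISIBILITY output shape (class-free).** In analytic rank `0`,
with GZK (`hGZK`), modularity (`hmod`) and `E[p]` irreducible: if `L(E,1)/Ω(W) = q₀ ∈ ℚ` and
`ord_p #Ш(E/ℚ)(p) + ord_p ∏_ℓ c_ℓ ≤ ord_p q₀`, then `ord_p #Ш ≤ ord_p #Ш_an`
(`Typed.MissingUpperBoundAt W p`). This is the shape Kim's Conjecture 1.9/1.10 ('≥' half: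
`∂^{(∞)}(δ̃) ≥ Σ ord_p c_ℓ`) delivers through Thm. 1.8 (6); NEITHER is assumed here. Dual of
`missingLowerBoundAt_of_rankZero_of_LOmegaWitness`. [cite: Miller2011LMS, §1 and Def. 1.1]
[cite: Kim2022StructureSelmer, Thm. 1.8 (6) and Conj. 1.9 (journal; = v4 Thm. 1.9, Conj. 1.10, PDF p. 8)] -/
theorem missingUpperBoundAt_of_rankZero_of_LOmegaDivisibility
    (hGZK : rank_eq_analyticRank_of_analyticRank_le_one) (hmod : hasEntireLFunction_rat)
    (hr : W.analyticRank = 0) (hirr : W.HasIrreducibleModPGaloisRep p)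
    {q₀ : ℚ} (hq₀ : W.entireLFunction 1 / (W.realPeriodRat : ℂ) = (q₀ : ℂ))
    (hd : (padicValNat p (Nat.card (AddCommGroup.primaryComponent W.sha p)) : ℤ) +
      padicValNat p W.tamagawaProduct ≤ padicValRat p q₀) :
    MissingUpperBoundAt W p := by
  have hL : W.entireLFunction 1 ≠ 0 := (W.analyticRank_eq_zero_iff_holds (hmod W)).mp hr
  haveI : Finite W.sha := (hGZK W (by rw [hr]; exact zero_le_one)).2
  have hΩ : (W.realPeriodRat : ℂ) ≠ 0 := Complex.ofReal_ne_zero.mpr W.realPeriodRat_pos_holds.ne'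
  have hq0 : q₀ ≠ 0 := by
    rintro rfl
    apply hL
    rw [← div_mul_cancel₀ (W.entireLFunction 1) hΩ, hq₀]; simp
  have hcard : (padicValNat p (Nat.card (AddCommGroup.primaryComponent W.sha p)) : ℤ) =
      padicValNat p W.shaOrder := by
    rw [WeierstrassCurve.shaOrder, padicValNat_card_addPrimaryComponent]
  refine ⟨_, Supersingular.shaAn_eq_of_analyticRank_eq_zero W hGZK hr hq₀, ?_⟩
  rw [Supersingular.padicValRat_shaAn_witness W p hirr hq0]
  linarith

/-- **Converse bookkeeping: the missing output gives BOTH shapes, with equality.** In analytic rank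
`0`, with GZK, modularity and `E[p]` irreducible, `Typed.MissingPPartAt W p` (`#Ш_an = q`,
`ord_p q = ord_p #Ш`) gives `L(E,1)/Ω(W) = q₀ := q · ∏ c_ℓ / #tors² ∈ ℚ` with
`ord_p q₀ − ord_p ∏ c_ℓ = ord_p #Ш(p)` — so the LOWER-WITNESS shape holds with `j = ord_p ∏ c_ℓ` and
the UPPER-DIVISIBILITY shape holds. [cite: Miller2011LMS, §1 and Def. 1.1 (arXiv:1010.2431 p. 3)] -/
theorem LOmegaShapes_of_missingPPartAt_rankZero
    (hGZK : rank_eq_analyticRank_of_analyticRank_le_one) (hmod : hasEntireLFunction_rat)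
    (hr : W.analyticRank = 0) (hirr : W.HasIrreducibleModPGaloisRep p) (h : MissingPPartAt W p) :
    ∃ q₀ : ℚ, W.entireLFunction 1 / (W.realPeriodRat : ℂ) = (q₀ : ℂ) ∧
      padicValRat p q₀ - padicValNat p W.tamagawaProduct =
        (padicValNat p (Nat.card (AddCommGroup.primaryComponent W.sha p)) : ℤ) := by
  have hL : W.entireLFunction 1 ≠ 0 := (W.analyticRank_eq_zero_iff_holds (hmod W)).mp hr
  haveI : Finite W.sha := (hGZK W (by rw [hr]; exact zero_le_one)).2
  obtain ⟨q, hq, hv⟩ := h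
  have hΩ : (W.realPeriodRat : ℂ) ≠ 0 := Complex.ofReal_ne_zero.mpr W.realPeriodRat_pos_holds.ne'
  have ht0 : (W.torsionOrder : ℚ) ≠ 0 := by exact_mod_cast (W.torsionOrder_pos_holds).ne'
  have hc0 : (W.tamagawaProduct : ℚ) ≠ 0 := by exact_mod_cast (W.tamagawaProduct_pos').ne'
  -- `L(E,1)/Ω(W)` is the rational `q₀ := q · ∏ c / #tors²`: compare the two expressions of `#Ш_an`
  obtain ⟨t, ht⟩ : ∃ t : ℚ, W.entireLFunction 1 / (W.realPeriodRat : ℂ) = (t : ℂ) := by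
    refine ⟨q * (W.tamagawaProduct : ℚ) / (W.torsionOrder : ℚ) ^ 2, ?_⟩
    have hmw0 : W.mordellWeilRank = 0 := (hGZK W (by rw [hr]; exact zero_le_one)).1.trans hr
    have hR : W.regulator = 1 := W.regulator_eq_one_of_rank_zero hmw0
    have ht0' : (W.torsionOrder : ℂ) ≠ 0 := by exact_mod_cast (W.torsionOrder_pos_holds).ne'
    have hc0' : (W.tamagawaProduct : ℂ) ≠ 0 := by exact_mod_cast (W.tamagawaProduct_pos').ne'
    have hsha := hq
    rw [shaAn_def, WeierstrassCurve.leadingLCoeff, hr, iteratedDeriv_zero, Nat.factorial_zero,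
      Nat.cast_one, div_one, hR] at hsha
    push_cast
    have h1 : W.entireLFunction 1 * (W.torsionOrder : ℂ) ^ 2 =
        (q : ℂ) * ((W.realPeriodRat : ℂ) * (W.tamagawaProduct : ℂ) * ((1 : ℝ) : ℂ)) := by
      rw [← hsha]
      field_simp
    push_cast at h1
    field_simp
    linear_combination h1
  have hsha' := Supersingular.shaAn_eq_of_analyticRank_eq_zero W hGZK hr ht
  have hqt : q = t * (W.torsionOrder : ℚ) ^ 2 / (W.tamagawaProduct : ℚ) := by
    exact_mod_cast hq.symm.trans hsha'
  have ht0q : t ≠ 0 := by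
    rintro rfl
    apply hL
    rw [← div_mul_cancel₀ (W.entireLFunction 1) hΩ, ht]; simp
  have hcard : (padicValNat p (Nat.card (AddCommGroup.primaryComponent W.sha p)) : ℤ) =
      padicValNat p W.shaOrder := by
    rw [WeierstrassCurve.shaOrder, padicValNat_card_addPrimaryComponent]
  refine ⟨t, ht, ?_⟩
  rw [hcard, ← hv, hqt, Supersingular.padicValRat_shaAn_witness W p hirr ht0q]

end ClassFree

/-! ### §2 The end state of X4 (r = 0, unit-free) in the Kurihara-number currency -/

/-- **X4♯(unit-free) ⟺ Kim's Conjecture 1.10 in OUTPUT FORM on the named rows ∧ EXOTIC(3).**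
Granted the eight PUBLISHED facts of gen 14's end state (`hKatoS` A161 sharp Kato; `hDel`
Delbourgo Prop. 4; `hmodD`; `hL20`; `hKatoχ`; `hK` Kato component; `hCT` Cassels–Tate) + GZK +
modularity, the typed conjecture `X4SharpUnitFree` (∀ X4 ∧ `r_an = 0` ∧ surj(p) pair,
`ord_p #Ш = ord_p #Ш_an`) is EQUIVALENT to the conjunction of
(i) the **LOWER-WITNESS shape on every X4 ∧ `r_an = 0` ∧ surj(p) pair** — `L(E,1)/Ω = q₀` with
`ord_p q₀ − j ≤ ord_p #Ш(p)` for some `j ≤ ord_p ∏ c_ℓ` (what ONE Kurihara number of valuation `j`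
delivers through Kim's Thm. 1.8 (6): the '≤' half of Conj. 1.10, finitely certifiable per pair);
(ii) the **EXOTIC residue at `3`** (the upper half on the potentially good surj(3) pairs whose
3-adic tower is not surjective — large image fails, no Kurihara-number theorem applies);
(iii) the **UPPER-DIVISIBILITY shape on the TAM-DEFECT₂♭ ∪ ODD-SHA♭ ∪ MANIN♭ pairs** —
`ord_p #Ш(p) + ord_p ∏ c_ℓ ≤ ord_p q₀` (what 'every `δ̃_n` is divisible by `p^{ord_p ∏ c_ℓ}`'
delivers: the '≥' half of Conj. 1.10, NOT finitely certifiable; proved at good ordinary `p` by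
Burungale–Castella–Grossi–Skinner, open at an additive `p`).
So the residue of class X4 (rank `0`, unit-free; RESIDUAL-MAP §I N11 ∪ N10 ∩ X4) is named
precisely: Kim's Conjecture 1.10 (its two halves, in output form, on the named rows) plus the
exotic-3-adic-image rows. NEITHER Kim's theorems NOR his conjecture is a hypothesis here; X4 stays
CONSTRUCTION-SHAPED; nothing is booked.
[cite: Kim2022StructureSelmer, Thm. 1.8 (6), §1.5.1 and Conj. 1.9 (journal; = v4 Thm. 1.9, Conj. 1.10, PDF pp. 7–8)]
[cite: Kato2004Asterisque, Thm. 14.5 (3) (p. 236), Prop. 14.16 (2) (p. 244), §13]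
[cite: Delbourgo1998, Prop. 4 (p. 144)] [cite: Wuthrich2014, Lemma 20 (p. 399) and Thm. 16]
[cite: SilvermanAEC2009, Thm. X.4.14] [cite: Miller2011LMS, §1 and Def. 1.1] -/
theorem x4SharpUnitFree_iff_kuriharaShapes_and_exotic
    (hCT : exists_casselsTate_pairing (K := ℚ))
    (hKatoS : Kato2004.rankZero_padicValNat_sha_le_sub_localTamagawa_of_additive_potGood_of_imageContainsSL2)
    (hDel : Delbourgo1998.prop4_rankZero_pow_dvd_constantCoeff)
    (hGZK : rank_eq_analyticRank_of_analyticRank_le_one) (hmod : hasEntireLFunction_rat)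
    (hmodD : nonempty_modularParametrizationData)
    (hL20 : Wuthrich2014.lemma20_surjective_threeAdic_of_semistable)
    (hKatoχ : Wuthrich2014.kato_halfEigenCharIdeal_dvd_cyclotomicPrime_of_surjective)
    (hK : Kato2004.charIdeal_dvd_padicLFunctionBranch_component_of_surjective) :
    X4SharpUnitFree ↔
      (∀ (W : WeierstrassCurve ℚ) [W.IsElliptic] [W.IsGloballyMinimal] (p : ℕ) [Fact p.Prime],
          W.analyticRank = 0 → ClassX4 W p → Surj W p →
          ∃ q₀ : ℚ, W.entireLFunction 1 / (W.realPeriodRat : ℂ) = (q₀ : ℂ) ∧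
            ∃ j : ℕ, j ≤ padicValNat p W.tamagawaProduct ∧
              padicValRat p q₀ - j ≤
                (padicValNat p (Nat.card (AddCommGroup.primaryComponent W.sha p)) : ℤ)) ∧
      (∀ (W : WeierstrassCurve ℚ) [W.IsElliptic] [W.IsGloballyMinimal],
          W.analyticRank = 0 → ClassX4 W 3 → Surj W 3 → 0 ≤ padicValRat 3 W.j →
          ¬ (∀ n : ℕ, W.HasSurjectiveModNGaloisRep (3 ^ n : ℕ)) → MissingUpperBoundAt W 3) ∧
      (∀ (W : WeierstrassCurve ℚ) [W.IsElliptic] [W.IsGloballyMinimal] (p : ℕ) [Fact p.Prime],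
          W.analyticRank = 0 → ClassX4 W p → Surj W p → 0 ≤ padicValRat p W.j →
          ¬ (TypeGOrd W p ∧ semistabilityIndex W p = 2) →
          (padicValNat p ((W.baseChange ℚ_[p]).localTamagawaNumber ℤ_[p]) + 2 ≤
              padicValNat p W.tamagawaProduct ∨
            (∃ q : ℚ, shaAn W = (q : ℂ) ∧ Odd (padicValRat p q)) ∨
            (∀ (N : ℕ) [NeZero N] (D : ModularParametrizationData W N), (p : ℤ) ∣ D.maninConstant)) →
          ∃ q₀ : ℚ, W.entireLFunction 1 / (W.realPeriodRat : ℂ) = (q₀ : ℂ) ∧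
            (padicValNat p (Nat.card (AddCommGroup.primaryComponent W.sha p)) : ℤ) +
              padicValNat p W.tamagawaProduct ≤ padicValRat p q₀) := by
  constructor
  · intro hX4
    -- every row has the missing output, hence both shapes (with equality)
    have hshapes : ∀ (W : WeierstrassCurve ℚ) [W.IsElliptic] [W.IsGloballyMinimal] (p : ℕ)
        [Fact p.Prime], W.analyticRank = 0 → ClassX4 W p → Surj W p →
        ∃ q₀ : ℚ, W.entireLFunction 1 / (W.realPeriodRat : ℂ) = (q₀ : ℂ) ∧
          padicValRat p q₀ - padicValNat p W.tamagawaProduct =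
            (padicValNat p (Nat.card (AddCommGroup.primaryComponent W.sha p)) : ℤ) :=
      fun W _ _ p _ hr hX hs ↦
        LOmegaShapes_of_missingPPartAt_rankZero W p hGZK hmod hr hX.2.2 (hX4 W p hr hX hs)
    refine ⟨fun W _ _ p _ hr hX hs ↦ ?_, ?_, fun W _ _ p _ hr hX hs _ _ _ ↦ ?_⟩
    · obtain ⟨q₀, hq₀, heq⟩ := hshapes W p hr hX hs
      exact ⟨q₀, hq₀, padicValNat p W.tamagawaProduct, le_rfl, heq.le⟩
    · exact ((x4SharpUnitFree_iff_lower_and_residues_sharp hCT hKatoS hDel hGZK hmod hmodD hL20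
        hKatoχ hK).mp hX4).2.1
    · obtain ⟨q₀, hq₀, heq⟩ := hshapes W p hr hX hs
      exact ⟨q₀, hq₀, by linarith⟩
  · rintro ⟨hlow, hexotic, hup⟩
    refine (x4SharpUnitFree_iff_lower_and_residues_sharp hCT hKatoS hDel hGZK hmod hmodD hL20
      hKatoχ hK).mpr ⟨fun W _ _ p _ hr hX hs ↦ ?_, hexotic, fun W _ _ p _ hr hX hs hj hG h2 ↦ ?_,
        fun W _ _ p _ hr hX hs hj hG ho ↦ ?_, fun W _ _ p _ hr hX hs hj hG hD ↦ ?_⟩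
    · obtain ⟨q₀, hq₀, j, hj, hw⟩ := hlow W p hr hX hs
      exact missingLowerBoundAt_of_rankZero_of_LOmegaWitness W p hGZK hmod hr hX.2.2 hq₀ hj hw
    · obtain ⟨q₀, hq₀, hd⟩ := hup W p hr hX hs hj hG (Or.inl h2)
      exact missingUpperBoundAt_of_rankZero_of_LOmegaDivisibility W p hGZK hmod hr hX.2.2 hq₀ hd
    · obtain ⟨q₀, hq₀, hd⟩ := hup W p hr hX hs hj hG (Or.inr (Or.inl ho))
      exact missingUpperBoundAt_of_rankZero_of_LOmegaDivisibility W p hGZK hmod hr hX.2.2 hq₀ hd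
    · obtain ⟨q₀, hq₀, hd⟩ := hup W p hr hX hs hj hG (Or.inr (Or.inr hD))
      exact missingUpperBoundAt_of_rankZero_of_LOmegaDivisibility W p hGZK hmod hr hX.2.2 hq₀ hd

end Summit.BirchSwinnertonDyer.Rank1Residual.Additive

end
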